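import Summits.ResolutionOfSingularities.ResolutionOfSingularities.Theorems.WeightedInvariantContactCylinderDefs
import Summits.ResolutionOfSingularities.ResolutionOfSingularities.Theorems.WeightedInvariantContactCylinderCompatibility
import HarnessLib

/-!
# The cylinder construction is FORCED by (J-loc): a centre filtration that localises along its centre and has primary
# values IS its own cylinder (door `HypersurfaceCentreConstruction`, stmt-ResolutionOfSingularities-19897; KEY
# `stub_localWeightedDropEFT4S`, rung P3; res-type-005, (o28) lead; IOTA3-DESIGN v1.2 §2.4 «this is FORCED too … lemma to type,
# in 005's (D1b) neighbourhood»)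

Topic: `Summits/ResolutionOfSingularities/ResolutionOfSingularities/Theorems`. Helper for the door item
`HypersurfaceCentreConstruction` (stmt-ResolutionOfSingularities-19897, route `WeightedInvariant`), def-free.  res-L1-w43-plan-1's
design of `J₃` (IOTA3-DESIGN v1.2 §2.4) takes `J₃ := ContactCylinder.jCylinder ι₃ J₂` along a permissible curve and remarks that
this is forced: the (J-loc) conjunct of the canonical game clause (c9′) says `J (S_P) (f/1) m = (J S f m)·S_P` along the centre
`P`, and weighted-monomial levels on parameters cutting out `P` are `P`-primary, so `J S f m = (J (S_P) (f/1) m) ∩ S`.  This file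
types exactly that:

* `cylinderAt_eq_self_of_loc` — any ring: (J-loc) at `P` plus «`J S f m` is contracted from `S_P`» give
  `cylinderAt J S P f m = J S f m`;
* `cylinderAt_eq_self_of_loc_of_eq_weightedMonomialIdeal` — regular local `S`: if `J S f m = (v; w)_m` for all `m`, `v ⊆ P` with
  independent differentials and positive weights `w` (res-type-005 g9's `comap_map_weightedMonomialIdeal_eq_of_linearIndependent`,
  p521270, over stub-10's primary lemma), then (J-loc) at `P` forces `cylinderAt J S P f m = J S f m`;
* `jCylinder_eq_self_of_loc_of_eq_weightedMonomialIdeal` — hence, when the top `ι`-stratum is `V(P)`, `jCylinder ι J S f m = J S f m`: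
  a centre filtration presented on the centre's parameters and obeying (J-loc) coincides with its cylinder, so the cylinder rule
  is the ONLY candidate extending such a `J` from the generic point of the stratum.

[OURS · L1 W4.3 · (o28)]  Replaces the role of NO printed item; NOT a statement of the manuscript
[claim: Hironaka2017, status: under-review]. AI work, weaker than expert review.

## References

* H. Matsumura, Commutative Ring Theory (1987), Thm. 16.2 (regular sequences; primary components), §4. [Matsumura1987]
* res-L1-w43-plan-1, IOTA3-DESIGN v1.2 §2.4 (OURS, AI planning).
-/

noncomputable section

open IsLocalRing Literature.AlgebraicGeometry.Resolution
open Summit.ResolutionOfSingularities.ResolutionOfSingularities.Cruxes.HypersurfaceCentreConstruction.LocalEngine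

set_option linter.dupNamespace false -- mandated namespace of this single-conjunct summit

namespace Summit.ResolutionOfSingularities.ResolutionOfSingularities.Theorems

namespace ContactCylinder

/-- **(J-loc) + contractedness ⇒ the cylinder is `J`** (any commutative ring): if `J (S_P) (f/1) m = (J S f m)·S_P` and
`(J S f m)·S_P ∩ S = J S f m` then `cylinderAt J S P f m = J S f m`. [folklore] -/
theorem cylinderAt_eq_self_of_loc (J : (R : Type) → [CommRing R] → R → ℕ → Ideal R) (S : Type) [CommRing S]
    (P : Ideal S) [P.IsPrime] (f : S) (m : ℕ)
    (hloc : J (Localization.AtPrime P) (algebraMap S (Localization.AtPrime P) f) m =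
      (J S f m).map (algebraMap S (Localization.AtPrime P)))
    (hcontr : ((J S f m).map (algebraMap S (Localization.AtPrime P))).comap (algebraMap S (Localization.AtPrime P)) =
      J S f m) :
    cylinderAt J S P f m = J S f m := by
  rw [cylinderAt_def, hloc, hcontr]

/-- **(J-loc) FORCES THE CYLINDER for centre filtrations presented on the centre's parameters.**  `S` regular local,
`v₁, …, v_N ∈ P` with independent differentials, positive weights `w`, `J S f m = (v; w)_m` for every `m`, and (J-loc) at the
prime `P`: then `cylinderAt J S P f m = J S f m` for every `m` (the levels are primary to `(v) ⊆ P`, hence contracted from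
`S_P`). [OURS · L1 W4.3 · (o28)] -/
theorem cylinderAt_eq_self_of_loc_of_eq_weightedMonomialIdeal (J : (R : Type) → [CommRing R] → R → ℕ → Ideal R)
    (S : Type) [CommRing S] [IsRegularLocalRing S] (P : Ideal S) [P.IsPrime] {N : ℕ} (v : Fin N → S)
    (hv : ∀ i, v i ∈ maximalIdeal S)
    (hli : LinearIndependent (ResidueField S) (fun i => (maximalIdeal S).toCotangent ⟨v i, hv i⟩))
    (hvP : ∀ i, v i ∈ P) (w : Fin N → ℕ) (hw : ∀ i, 0 < w i) (f : S)
    (hval : ∀ m, J S f m = weightedMonomialIdeal v w m)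
    (hloc : ∀ m, J (Localization.AtPrime P) (algebraMap S (Localization.AtPrime P) f) m =
      (J S f m).map (algebraMap S (Localization.AtPrime P)))
    (m : ℕ) : cylinderAt J S P f m = J S f m := by
  refine cylinderAt_eq_self_of_loc J S P f m (hloc m) ?_
  rcases Nat.eq_zero_or_pos m with rfl | hm
  · rw [hval 0, weightedMonomialIdeal_zero, Ideal.map_top, Ideal.comap_top]
  · rw [hval m]
    exact comap_map_weightedMonomialIdeal_eq_of_linearIndependent P v hv hli hvP w hw hm

/-- **… so the cylinder construction returns `J` itself** when, moreover, the top `ι`-stratum of `f` is `V(P)`: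
`jCylinder ι J S f m = J S f m`.  A centre filtration obeying (J-loc) and presented on the centre's parameters is its own
cylinder — the cylinder rule of ORDER (o28) is the unique extension of such a `J` from the generic point of the stratum.
[OURS · L1 W4.3 · (o28)] -/
theorem jCylinder_eq_self_of_loc_of_eq_weightedMonomialIdeal (ι : (R : Type) → [CommRing R] → R → Ordinal.{0})
    (J : (R : Type) → [CommRing R] → R → ℕ → Ideal R) (S : Type) [CommRing S] [IsRegularLocalRing S] (P : Ideal S)
    [P.IsPrime] {N : ℕ} (v : Fin N → S) (hv : ∀ i, v i ∈ maximalIdeal S)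
    (hli : LinearIndependent (ResidueField S) (fun i => (maximalIdeal S).toCotangent ⟨v i, hv i⟩))
    (hvP : ∀ i, v i ∈ P) (w : Fin N → ℕ) (hw : ∀ i, 0 < w i) (f : S)
    (hE : topStratum ι S f = {𝔮 | P ≤ 𝔮.asIdeal})
    (hval : ∀ m, J S f m = weightedMonomialIdeal v w m)
    (hloc : ∀ m, J (Localization.AtPrime P) (algebraMap S (Localization.AtPrime P) f) m =
      (J S f m).map (algebraMap S (Localization.AtPrime P)))
    (m : ℕ) : jCylinder ι J S f m = J S f m := by
  rw [jCylinder_eq_of_topStratum_eq ι J S f m hE, ← cylinderAt_def]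
  exact cylinderAt_eq_self_of_loc_of_eq_weightedMonomialIdeal J S P v hv hli hvP w hw f hval hloc m

end ContactCylinder

end Summit.ResolutionOfSingularities.ResolutionOfSingularities.Theorems

end
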